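import Literature.MathematicalPhysics.QuantumFieldTheory.Balaban1983to89.B12RT013TwoLevel

/-!
# `Balaban1983to89.B12Eq21Body265` — [Balaban1987RG1] (2.1) p. 265: the sentence «𝐄_k … is equal to (1/g_k²)A + A_k»
# WITH BODY, the tower forms of `𝐓_kA_k = (2.1)`, and (2.1) at the paper's own `T_k` and `𝐆`

HONEST FRAMING (cell `lit-balaban`, verbatim): statement-level skeleton of published theorems with citation tags;
proofs where landed; nothing here is a claim about the Yang–Mills mass gap.

CITATION HEADER.  T. Bałaban, *Renormalization group approach to lattice gauge field theories. I. Generation of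
effective actions in a small field approximation and a coupling constant renormalization in four dimensions*,
Commun. Math. Phys. **109** (1987) 249–301 [Balaban1987RG1] (cell paper B12 = "[I]"), §2 p. 265; held text
`paper:balaban1987-cmp109-rg-i-small-field` p. 17 re-read by this seat (2026-08-23), display against the reader row cell
B12.Eq2.1 of `HOME/lit-balaban-r09/ROWS-B12.md` (render-checked v2.76: print writes one `δ(V̄W⁻¹)`).

WHAT IS QUOTED (p. 265).  «We assume that after k steps we have obtained the action A_k described in the previous
section, and we apply the next renormalization transformation T_k restricted to a small field region by a characteristic
function χ_k:
(𝐓_kA_k)(W) = log 𝐍_k⁻¹ ∫dV δ(V̄W⁻¹) χ_k exp[−(1/g_k²)𝐆(V) − (1/g_k²)A(U_k(V)) + 𝐄_k(U_k(V))]. (2.1)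
… The meaning of the function 𝐄_k is obvious, it is equal to (1/g_k²)A + A_k. … We will define the characteristic
function χ_k in such a way that the domain of integration in (2.1) is restricted to configurations V for which
U_k(V) ∈ U_k(ε₀). Thus the inductive assumption of the previous section is valid for the action A_k(U_k(V)).»

DIVISION OF LABOUR (coordination r20 g44 ↔ r09 g42, HOME/STATUS 2026-08-23T11:44Z / 11:57Z / 12:00Z / 12:09Z).  The
display (2.1) WITH BODY over the cell's renormalization-transformation operator — `B12Eq019ActionBody.action21 T χ 𝐆 g_k
U_k A 𝐄_k := nextAction T χ 𝐆 g_k (V ↦ −(1/g_k²)A(U_k V) + 𝐄_k(U_k V))` — and `𝐓_kA_k = (2.1)` under print's proviso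
(`nextAction_eq_action21`, `nextAction_eq_action21_of_representation`, `Ek_eq_of_repr`) are r20's §6 of
`B12Eq019ActionBody` (v1.1), USED BY NAME here, never re-declared.  THIS MODULE ADDS (definitions WITH BODIES + theorems;
0 `Prop`-facts, 0 sorry):
* §1 **`EkOf g_k A A_k := (1/g_k²)A + A_k`** — the sentence «𝐄_k … is equal to (1/g_k²)A + A_k» as a DEFINITION WITH
  BODY (a function of the background configuration; `A` print's fine action, `A_k` read as a function of `U_k` as in
  «the action A_k(U_k(V))»); `action21_EkOf` — substituting it into (2.1) returns the step (0.19) applied to `A_k ∘ U_k`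
  (the two printed sentences compose); `ek_sentence_iff` — on any domain the 𝐄_k-sentence IS the representation (0.22).
* §2 TOWER FORMS of `𝐓_kA_k = (2.1)` over the cell's `Step.SFTower`: `nextAction_eq_action21_of_form13` (the `form13`
  clause of `Step.GeneratedBySmallFieldRT` — `A_k = (1.3) ∘ U_k` on the background domain — with `𝐄_k := EkOf g_k A
  (action13 k)`), `nextAction_eq_action21_of_generatedBySmallFieldRT` (read off the record itself, `k ≤ K`),
  `nextAction_eq_action21_of_form16` (the (1.6)/(0.22)–(0.23) reading, `𝐄_k = Step.SFTower.Ek k` by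
  `Step.SFTower.action16_eq`), `Ek_eq_EkOf_action16` (in that reading print's sentence holds literally:
  `SFTower.Ek k = EkOf g_k A (action16 k)`).
* §3 **(2.1) AT THE PAPER'S OWN OBJECTS** (`B12RT013TwoLevel`, p363431): `printedStep21 𝓜 ℰ …` := `action21` at print's
  δ-kernel transformation `rtOpITwoLevel 𝓜 ℰ` for `V̄` = the two-level average (0.12) (Radon–Nikodym reading, DIVERGENCE
  F7) and print's gauge-fixing function `gf017 𝓜` over the variables (0.11); `printedStep21_eq_printedNextAction`
  (= print's (0.19) `printedNextAction` at the (0.22)-form, `rfl`), `printedNextAction_eq_printedStep21` (`𝐓_kA_k = (2.1)`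
  at print's objects under the proviso), `printedNextAction_eq_printedStep21_of_representation`.
The other printed sentences of row B12.Eq2.1 are ALREADY theorems of the tree and are only cited: the gauge clause
(`B12RTGaugeInvariance254.isRT_comp_gaugeAct` / `smallFieldStep_gaugeInvariant_ae` p249583; at the level of the
δ-functions' argument `B12Average012Covariance` p255267), «⇒ |W(∂p′) − 1| < 2ε₀, Prop 2 [12]»
(`B12Prop2Claims260.Claim265Printed_holds` p244024; for [I]'s own average `B12Average012Prop2.claim265_012` p256666),
«This does not change the expressions in (2.1)» (`B12GaugeOrbits021.exprs21_invariant` p252882).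

WHAT THIS IS NOT.  No claim that the support proviso holds for the printed `χ_k` (that is the construction of `χ_k` in
(2.9), row B12.Eq2.9, and [15]); no positivity of `T_k(χ_k e^{…})` (print takes the log; only hypothesis-free identities
here); nothing on the saddle-point analysis (2.2)–(2.15).  In §2 `A` is the cell's `d = 4` Wilson action `wilsonAction4`
(DIVERGENCE F10: print's `A` / `A^η` on the η-lattice), as in `Step.SFTower.action13/action16`.
-/

noncomputable section

namespace Literature.MathematicalPhysics.QuantumFieldTheory.Balaban1983to89.B12Eq21Body265

open Literature.MathematicalPhysics.QuantumFieldTheory.Balaban1983to89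
open B12Eq019ActionBody

/-! ## 1. «The meaning of the function 𝐄_k is obvious, it is equal to (1/g_k²)A + A_k» — with body -/

section EkSentence

variable {P : Params} {G : Type*} [GaugeGroup G] {k : ℕ}

/-- **The sentence «𝐄_k … is equal to (1/g_k²)A + A_k» WITH BODY**: as a function of the background configuration,
`𝐄_k := (1/g_k²)A + A_k` (`Aη` = print's fine-lattice action `A`, `Ak` = the `k`-th action read as a function of the
background field `U_k`, as print does in «the action A_k(U_k(V))»). [cite: Balaban1987RG1, (2.1) p.265] -/
def EkOf (gk : ℝ) (Aη Ak : GaugeField P 0 G → ℝ) : GaugeField P 0 G → ℝ :=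
  fun U => (1 / gk ^ 2) * Aη U + Ak U

omit [GaugeGroup G] in
/-- Unfolding of `EkOf`. [cite: Balaban1987RG1, (2.1) p.265] -/
theorem EkOf_apply (gk : ℝ) (Aη Ak : GaugeField P 0 G → ℝ) (U : GaugeField P 0 G) :
    EkOf gk Aη Ak U = (1 / gk ^ 2) * Aη U + Ak U := rfl

omit [GaugeGroup G] in
/-- Substituting `𝐄_k = (1/g_k²)A + A_k` into the (0.22)-form returns `A_k ∘ U_k`:
`−(1/g_k²)A(U_k V) + 𝐄_k(U_k V) = A_k(U_k V)`. [cite: Balaban1987RG1, (2.1) p.265] -/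
theorem repr_EkOf (gk : ℝ) (Uk : GaugeField P k G → GaugeField P 0 G) (Aη Ak : GaugeField P 0 G → ℝ) :
    (fun V => -(1 / gk ^ 2) * Aη (Uk V) + EkOf gk Aη Ak (Uk V)) = fun V => Ak (Uk V) := by
  funext V
  rw [EkOf_apply]
  ring

/-- **The two printed sentences compose**: (2.1) with `𝐄_k := (1/g_k²)A + A_k` IS the step (0.19) applied to
`V ↦ A_k(U_k(V))` — `action21 T χ 𝐆 g_k U_k A (EkOf g_k A A_k) = nextAction T χ 𝐆 g_k (A_k ∘ U_k)`.
[cite: Balaban1987RG1, (2.1) p.265] -/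
theorem action21_EkOf (T : Density P k G → Density P (k+1) G) (χ GF : Density P k G) (gk : ℝ)
    (Uk : GaugeField P k G → GaugeField P 0 G) (Aη Ak : GaugeField P 0 G → ℝ) :
    action21 T χ GF gk Uk Aη (EkOf gk Aη Ak) = nextAction T χ GF gk (fun V => Ak (Uk V)) := by
  rw [action21_eq, repr_EkOf]

omit [GaugeGroup G] in
/-- The 𝐄_k-sentence and the representation (0.22) are THE SAME STATEMENT on any domain: `𝐄_k(U_k V) = (1/g_k²)A(U_k V)
+ A_k(V)` for `V ∈ dom` iff `A_k(V) = −(1/g_k²)A(U_k V) + 𝐄_k(U_k V)` for `V ∈ dom` (r20's `Ek_eq_of_repr` is the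
direction ⇐). [cite: Balaban1987RG1, (2.1) p.265, (0.22) p.256] -/
theorem ek_sentence_iff (gk : ℝ) (Uk : GaugeField P k G → GaugeField P 0 G) (A : Density P k G)
    (Aη Ek : GaugeField P 0 G → ℝ) (dom : Set (GaugeField P k G)) :
    (∀ V ∈ dom, Ek (Uk V) = (1 / gk ^ 2) * Aη (Uk V) + A V) ↔
      (∀ V ∈ dom, A V = -(1 / gk ^ 2) * Aη (Uk V) + Ek (Uk V)) := by
  constructor
  · intro h V hV; rw [h V hV]; ring
  · intro h V hV; rw [h V hV]; ring

/-- With `𝐄_k := EkOf g_k A (A_k read on the background field)`, the representation (0.22) holds TAUTOLOGICALLY on the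
domain where `A_k(V) = A_k^{bg}(U_k(V))`; hence there `𝐓_kA_k = (2.1)` with this `𝐄_k` (r20's `nextAction_eq_action21`).
[cite: Balaban1987RG1, (2.1) p.265] -/
theorem nextAction_eq_action21_EkOf (T : Density P k G → Density P (k+1) G) {χ : Density P k G} (GF : Density P k G)
    (gk : ℝ) {A : Density P k G} {dom : Set (GaugeField P k G)} {Uk : GaugeField P k G → GaugeField P 0 G}
    (Aη : GaugeField P 0 G → ℝ) {Abg : GaugeField P 0 G → ℝ} (hχ : ∀ V, χ V ≠ 0 → V ∈ dom)
    (hA : ∀ V ∈ dom, A V = Abg (Uk V)) :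
    nextAction T χ GF gk A = action21 T χ GF gk Uk Aη (EkOf gk Aη Abg) :=
  nextAction_eq_action21 T GF gk hχ fun V hV => by rw [hA V hV, EkOf_apply]; ring

end EkSentence

/-! ## 2. Tower forms of `𝐓_kA_k = (2.1)` over the cell's `Step.SFTower` -/

section Tower

variable {P : Params} {G : Type*} [GaugeGroup G] {Φ 𝒢 : Type*}

/-- TOWER FORM over the `form13`-type clause (`A_k = (1.3) ∘ U_k` on the background domain, as in the cell's record
`Step.GeneratedBySmallFieldRT`): then `𝐓_kA_k = (2.1)` with `𝐄_k := (1/g_k²)A + (1.3)` — print's «equal to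
(1/g_k²)A + A_k». [cite: Balaban1987RG1, (2.1) p.265, (1.3) p.260] -/
theorem nextAction_eq_action21_of_form13 (Tw : Step.SFTower P G Φ 𝒢) {av : ∀ j, Averaging P j G}
    (bg : Background P G av) (A : ∀ k, Density P k G) (k : ℕ)
    (hform : ∀ V ∈ bg.dom k, A k V = Tw.action13 k (bg.U k V))
    (T : Density P k G → Density P (k+1) G) {χ : Density P k G} (GF : Density P k G)
    (hχ : ∀ V, χ V ≠ 0 → V ∈ bg.dom k) :
    nextAction T χ GF (Tw.flow.g k) (A k)
      = action21 T χ GF (Tw.flow.g k) (bg.U k) wilsonAction4 (EkOf (Tw.flow.g k) wilsonAction4 (Tw.action13 k)) :=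
  nextAction_eq_action21_EkOf T GF _ wilsonAction4 hχ hform

/-- The same read off the cell's Theorem-3 record `Step.GeneratedBySmallFieldRT av Tk χ GF bg A Tw K` (its `form13`
field), at every level `k ≤ K` and for any operator and cut-off supported in `bg.dom k`. [cite: Balaban1987RG1, (2.1) p.265] -/
theorem nextAction_eq_action21_of_generatedBySmallFieldRT [MeasurableSpace G] [HaarData G]
    {av : ∀ j, Averaging P j G} {Tk : ∀ k, RTOp P k G (av k)} {χ₀ GF₀ : ∀ k, Density P k G}
    {bg : Background P G av} {A : ∀ k, Density P k G} {Tw : Step.SFTower P G Φ 𝒢} {K : ℕ}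
    (hgen : Step.GeneratedBySmallFieldRT av Tk χ₀ GF₀ bg A Tw K) {k : ℕ} (hk : k ≤ K)
    (T : Density P k G → Density P (k+1) G) {χ : Density P k G} (GF : Density P k G)
    (hχ : ∀ V, χ V ≠ 0 → V ∈ bg.dom k) :
    nextAction T χ GF (Tw.flow.g k) (A k)
      = action21 T χ GF (Tw.flow.g k) (bg.U k) wilsonAction4 (EkOf (Tw.flow.g k) wilsonAction4 (Tw.action13 k)) :=
  nextAction_eq_action21_of_form13 Tw bg A k (hgen.form13 k hk) T GF hχ

/-- TOWER FORM in the (1.6)/(0.22)–(0.23) reading (`Step.SFTower.action16_eq`: `A_k(U) = −(1/g_k²)A(U) + 𝐄_k(U)` with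
`𝐄_k = Step.SFTower.Ek` the sum (0.23)): if `A_k = (1.6) ∘ U_k` on the background domain and `χ_k` is supported there,
then `𝐓_kA_k = (2.1)` with print's own `𝐄_k`. [cite: Balaban1987RG1, (2.1) p.265, (0.23) p.256] -/
theorem nextAction_eq_action21_of_form16 (Tw : Step.SFTower P G Φ 𝒢) {av : ∀ j, Averaging P j G}
    (bg : Background P G av) (A : ∀ k, Density P k G) (k : ℕ)
    (hform : ∀ V ∈ bg.dom k, A k V = Tw.action16 k (bg.U k V))
    (T : Density P k G → Density P (k+1) G) {χ : Density P k G} (GF : Density P k G)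
    (hχ : ∀ V, χ V ≠ 0 → V ∈ bg.dom k) :
    nextAction T χ GF (Tw.flow.g k) (A k) = action21 T χ GF (Tw.flow.g k) (bg.U k) wilsonAction4 (Tw.Ek k) :=
  nextAction_eq_action21 T GF _ hχ fun V hV => by rw [hform V hV, Step.SFTower.action16_eq]

/-- In the (1.6) reading print's sentence holds LITERALLY: `𝐄_k = (1/g_k²)A + A_k` with `A_k = action16 k`,
`𝐄_k = Step.SFTower.Ek k` (as functions of the background configuration). [cite: Balaban1987RG1, (2.1) p.265] -/
theorem Ek_eq_EkOf_action16 (Tw : Step.SFTower P G Φ 𝒢) (k : ℕ) :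
    Tw.Ek k = EkOf (Tw.flow.g k) wilsonAction4 (Tw.action16 k) := by
  funext U
  rw [EkOf_apply, Step.SFTower.action16_eq]
  ring

end Tower

/-! ## 3. (2.1) at the paper's own objects: print's `T_k` for `V̄` = (0.12) and `𝐆` over the variables (0.11) -/

section Printed

open B12RT013TwoLevel BlockAveragingTwoLevel T4FiniteEpsInhabited

variable {P : Params} {j : ℕ} {G : Type*} [GaugeGroup G] [MeasurableSpace G] [HaarData G] [RegularGaugeGroup G]
variable (𝓜 : GroupAverage G) (ℰ : LoopAverage G)

/-- **(2.1) AT THE PAPER'S OWN OBJECTS**: `(𝐓_jA_j)(W) = log 𝐍_j⁻¹ ∫dV δ(V̄W⁻¹) χ_j exp[−(1/g_j²)𝐆(V) − (1/g_j²)A(U_j(V))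
+ 𝐄_j(U_j(V))]` with `V̄` the two-level average (0.12) — the δ-integral being print's transformation `rtOpITwoLevel 𝓜 ℰ`
in the Radon–Nikodym reading F7 — and `𝐆` the exponential gauge-fixing function over the variables (0.11) (`gf017 𝓜`):
r20's `action21` at these objects. [cite: Balaban1987RG1, (2.1) p.265] -/
def printedStep21 (hM : 𝓜.MeasurableM) (hE : ℰ.MeasurableE)
    (hac : HaarAC (avgFun₂ 𝓜 ℰ : GaugeField P j G → GaugeField P (j+1) G))
    (χ : Density P j G) (gk : ℝ) (Uk : GaugeField P j G → GaugeField P 0 G) (Aη Ek : GaugeField P 0 G → ℝ) :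
    Density P (j+1) G :=
  action21 (rtOpITwoLevel 𝓜 ℰ hM hE hac).T χ (gf017 𝓜 Finset.univ) gk Uk Aη Ek

variable {𝓜 ℰ}

/-- At print's objects, (2.1) is print's (0.19) (`B12RT013TwoLevel.printedNextAction`) at the (0.22)-form action
(definitional). [cite: Balaban1987RG1, (2.1) p.265] -/
theorem printedStep21_eq_printedNextAction (hM : 𝓜.MeasurableM) (hE : ℰ.MeasurableE)
    (hac : HaarAC (avgFun₂ 𝓜 ℰ : GaugeField P j G → GaugeField P (j+1) G))
    (χ : Density P j G) (gk : ℝ) (Uk : GaugeField P j G → GaugeField P 0 G) (Aη Ek : GaugeField P 0 G → ℝ) :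
    printedStep21 𝓜 ℰ hM hE hac χ gk Uk Aη Ek
      = printedNextAction 𝓜 ℰ hM hE hac χ gk (fun V => -(1 / gk ^ 2) * Aη (Uk V) + Ek (Uk V)) := rfl

/-- **At print's objects, `𝐓_jA_j = (2.1)`** whenever `χ_j` is supported in a domain on which the representation (0.22)
of `A_j` holds (print's proviso). [cite: Balaban1987RG1, (2.1) p.265] -/
theorem printedNextAction_eq_printedStep21 (hM : 𝓜.MeasurableM) (hE : ℰ.MeasurableE)
    (hac : HaarAC (avgFun₂ 𝓜 ℰ : GaugeField P j G → GaugeField P (j+1) G))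
    {χ : Density P j G} (gk : ℝ) {A : Density P j G} {dom : Set (GaugeField P j G)}
    {Uk : GaugeField P j G → GaugeField P 0 G} {Aη Ek : GaugeField P 0 G → ℝ} (hχ : ∀ V, χ V ≠ 0 → V ∈ dom)
    (h022 : ∀ V ∈ dom, A V = -(1 / gk ^ 2) * Aη (Uk V) + Ek (Uk V)) :
    printedNextAction 𝓜 ℰ hM hE hac χ gk A = printedStep21 𝓜 ℰ hM hE hac χ gk Uk Aη Ek :=
  nextAction_eq_action21 _ _ gk hχ h022

/-- The same from the cell's representation record `Setup.EffActionSeq.Representation` (0.22) (`A` = `wilsonAction4`,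
`U_j = bg.U j`), for a cut-off supported in `bg.dom j`. [cite: Balaban1987RG1, (2.1) p.265, (0.22) p.256] -/
theorem printedNextAction_eq_printedStep21_of_representation (hM : 𝓜.MeasurableM) (hE : ℰ.MeasurableE)
    (hac : HaarAC (avgFun₂ 𝓜 ℰ : GaugeField P j G → GaugeField P (j+1) G))
    {χ : Density P j G} {S : EffActionSeq P G} {av : ∀ i, Averaging P i G} {bg : Background P G av}
    {E : ℕ → GaugeField P 0 G → ℝ} (hrep : S.Representation bg E) (hχ : ∀ V, χ V ≠ 0 → V ∈ bg.dom j) :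
    printedNextAction 𝓜 ℰ hM hE hac χ (S.flow.g j) (S.A j)
      = printedStep21 𝓜 ℰ hM hE hac χ (S.flow.g j) (bg.U j) wilsonAction4 (E j) :=
  nextAction_eq_action21_of_representation _ _ hrep hχ

end Printed

end Literature.MathematicalPhysics.QuantumFieldTheory.Balaban1983to89.B12Eq21Body265
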